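import Mathlib
import Summits.NavierStokesRegularity.NavierStokesRegularity.Theorems.TaoLadderRungTwoBreakOneShiftFrameRows
import HarnessLib

/-!
# Kernel STAGE 3, frame rows (top side): the contraction rows of all top shells `k ≥ W+1` from the row at
# `k = W+1` on a geometric top frame (cell harvest/h2-tao-ladder, seat p2; rung1/KERNEL-STAGE3-PLAN.md brick (7);
# support for K1(1) = `NoSurvivingDSSOne`, stmt-NavierStokesRegularity-20205)

MODEL lattice ODEs only; nothing about the Navier–Stokes equations; no item closed; CONDITIONAL glue.
Companion of `…OneShiftFrameRows` (wake side, p624076). Top frame: weights `wt_{W+j} = ω_t ϑ^j`, amplitudes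
`A_{W+j} ≤ ā_t ϑ_A^j`, rates `R_{W+j} ≤ r̄_t σ_t^j`, distance coefficients `D_{W+j} ≤ ω_t ϑ^j`, with
`0 < ϑ ≤ 1`, `0 ≤ ϑ_A ≤ ϑ`, `0 ≤ σ_t ≤ ϑ`, `Λ ϑ_A ≤ 1` (i.e. `Γ′ ≤ Γ`, `Λ < Γ` of STAGE 2/3). Then every term of
the row at `k = W+n+1` is at most `ϑⁿ` times its value at `k = W+1` (`quadTermLip_top_le`, `top_rows_of_first`).
-/

noncomputable section

-- `Summit.NavierStokesRegularity.NavierStokesRegularity.…` is the tree's (summit = problem) namespace; the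
-- duplicated component is intended, so the dupNamespace linter is silenced for this file.
set_option linter.dupNamespace false

namespace Summit.NavierStokesRegularity.NavierStokesRegularity.Theorems

namespace DSSOneShift

open Set MeasureTheory intervalIntegral
open Literature.Analysis.FluidPDE Literature.Analysis.FluidPDE.TaoCascade CertificateGlueOn

variable {m : ℕ}

namespace OneShiftFrame

variable (F : OneShiftFrame m)

/-- **Geometric envelope of the Lipschitz functional on the TOP.** At the top shell `k = W+n+1` (the three shells
read, `W+n … W+n+2`, are tail shells): with `D_{W+j} ≤ ω_t ϑ^j`, `0 ≤ A_{W+j} ≤ ā_t ϑ_A^j` (`ϑ, ϑ_A ≤ 1`, `Λ ≥ 1`),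
`quadTermLip(A,D)(i,k) ≤ 2 (Σ|α|) Λ^{W+n+1} (ω_t ϑⁿ) (ā_t ϑ_Aⁿ)`.
[cite: Tao2016AveragedNS, §4 (4.8); cell vocabulary, harvest/h2-tao-ladder rung1/STAGE3-BANACH.md §2 (θ_t)] -/
theorem quadTermLip_top_le {ε₀ ωt ϑ abart ϑA : ℝ} (hε : 0 < 1 + ε₀) (hΛ1 : 1 ≤ bigLam ε₀)
    (hϑ0 : 0 ≤ ϑ) (hϑ1 : ϑ ≤ 1) (hϑA0 : 0 ≤ ϑA) (hϑA1 : ϑA ≤ 1) (hωt : 0 ≤ ωt) (habart : 0 ≤ abart)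
    (α : Fin m → Fin m → Fin m → ℤ × ℤ × ℤ → ℝ) {A D : ℤ → ℝ}
    (hAnn : ∀ k', 0 ≤ A k') (hDnn : ∀ k', 0 ≤ D k')
    (hD : ∀ j : ℕ, D ((F.W : ℤ) + j) ≤ ωt * ϑ ^ j) (hA : ∀ j : ℕ, A ((F.W : ℤ) + j) ≤ abart * ϑA ^ j)
    (i : Fin m) (n : ℕ) :
    quadTermLip ε₀ α A D i ((F.W : ℤ) + n + 1) ≤
      2 * tableAbsSum α i * (bigLam ε₀) ^ (F.W + n + 1) * (ωt * ϑ ^ n) * (abart * ϑA ^ n) := by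
  have hΛpos : 0 < bigLam ε₀ := bigLam_pos (by linarith)
  set k : ℤ := (F.W : ℤ) + n + 1 with hk
  set X := ωt * ϑ ^ n with hX
  set Y := abart * ϑA ^ n with hY
  have hX0 : 0 ≤ X := mul_nonneg hωt (pow_nonneg hϑ0 _)
  have hY0 : 0 ≤ Y := mul_nonneg habart (pow_nonneg hϑA0 _)
  have hDa : ∀ a : ℤ, k - 1 ≤ a → a ≤ k + 1 → D a ≤ X := by
    intro a ha1 ha2
    obtain ⟨j, hj⟩ : ∃ j : ℕ, a = (F.W : ℤ) + j := ⟨(a - F.W).toNat, by omega⟩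
    rw [hj]
    refine (hD j).trans (mul_le_mul_of_nonneg_left (pow_le_pow_of_le_one hϑ0 hϑ1 (by omega)) hωt)
  have hAb : ∀ b : ℤ, k - 1 ≤ b → b ≤ k + 1 → A b ≤ Y := by
    intro b hb1 hb2
    obtain ⟨j, hj⟩ : ∃ j : ℕ, b = (F.W : ℤ) + j := ⟨(b - F.W).toNat, by omega⟩
    rw [hj]
    refine (hA j).trans (mul_le_mul_of_nonneg_left (pow_le_pow_of_le_one hϑA0 hϑA1 (by omega)) habart)
  have hgainK : (bigLam ε₀) ^ k = (bigLam ε₀) ^ (F.W + n + 1) := by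
    rw [hk, show ((F.W : ℤ) + n + 1) = ((F.W + n + 1 : ℕ) : ℤ) by push_cast; ring, zpow_natCast]
  have h1 : quadTermLip ε₀ α A D i k ≤
      ∑ i₁ : Fin m, ∑ i₂ : Fin m, ∑ μ ∈ shiftSet, |α i₁ i₂ i μ| * ((bigLam ε₀) ^ k * (X * Y + Y * X)) := by
    unfold quadTermLip
    refine Finset.sum_le_sum fun i₁ _ => Finset.sum_le_sum fun i₂ _ => Finset.sum_le_sum fun μ hμ => ?_
    obtain ⟨⟨ha1, ha2⟩, ⟨hb1, hb2⟩, ⟨_, hg2⟩⟩ := shiftSet_index_bounds hμ k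
    have hgain : (1 + ε₀) ^ ((5 : ℝ) * (k - μ.2.2) / 2) ≤ (bigLam ε₀) ^ k := by
      have e := bigLam_zpow_eq_rpow hε (k - μ.2.2)
      push_cast at e
      rw [e]
      exact zpow_le_zpow_right₀ hΛ1 hg2
    have hprod : D (k - μ.2.2 + μ.1) * A (k - μ.2.2 + μ.2.1) + A (k - μ.2.2 + μ.1) * D (k - μ.2.2 + μ.2.1) ≤
        X * Y + Y * X :=
      add_le_add (mul_le_mul (hDa _ ha1 ha2) (hAb _ hb1 hb2) (hAnn _) hX0)
        (mul_le_mul (hAb _ ha1 ha2) (hDa _ hb1 hb2) (hDnn _) hY0)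
    have hα0 : 0 ≤ |α i₁ i₂ i μ| := abs_nonneg _
    have hpn : 0 ≤ D (k - μ.2.2 + μ.1) * A (k - μ.2.2 + μ.2.1) + A (k - μ.2.2 + μ.1) * D (k - μ.2.2 + μ.2.1) :=
      add_nonneg (mul_nonneg (hDnn _) (hAnn _)) (mul_nonneg (hAnn _) (hDnn _))
    rw [mul_assoc]
    refine mul_le_mul_of_nonneg_left ?_ hα0
    exact mul_le_mul hgain hprod hpn (zpow_nonneg hΛpos.le _)
  calc quadTermLip ε₀ α A D i k
      ≤ ∑ i₁ : Fin m, ∑ i₂ : Fin m, ∑ μ ∈ shiftSet, |α i₁ i₂ i μ| * ((bigLam ε₀) ^ k * (X * Y + Y * X)) := h1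
    _ = tableAbsSum α i * ((bigLam ε₀) ^ k * (X * Y + Y * X)) := by
        unfold tableAbsSum; simp only [Finset.sum_mul]
    _ = 2 * tableAbsSum α i * (bigLam ε₀) ^ (F.W + n + 1) * X * Y := by rw [hgainK]; ring

/-- **TOP ROWS FROM THE FIRST INTERIOR ROW.** On a geometric top frame (weights `wt_{W+j} = ω_t ϑ^j`, amplitudes
`A_{W+j} ≤ ā_t ϑ_A^j`, rates `R_{W+j} ≤ r̄_t σ_t^j`, `D_{W+j} ≤ ω_t ϑ^j`, `0 < ϑ ≤ 1`, `0 ≤ ϑ_A ≤ ϑ`, `0 ≤ σ_t ≤ ϑ`,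
`Λ ϑ_A ≤ 1`) every term of the contraction row at `k = W+n+1` is at most `ϑⁿ` times its value at `k = W+1`;
hence the single inequality at `k = W+1` gives all rows `k ≥ W+1`.
[cite: Tao2016AveragedNS, §4 (4.8); cell vocabulary, harvest/h2-tao-ladder rung1/STAGE3-BANACH.md §2 (θ_t; top block g_hi/Γ′)] -/
theorem top_rows_of_first {ε₀ ωt ϑ abart ϑA rbart σt gHi γ q : ℝ} (hε : 0 < 1 + ε₀) (hΛ1 : 1 ≤ bigLam ε₀)
    (hϑ0 : 0 < ϑ) (hϑ1 : ϑ ≤ 1) (hϑA0 : 0 ≤ ϑA) (hϑAϑ : ϑA ≤ ϑ) (hσt : 0 ≤ σt) (hσtϑ : σt ≤ ϑ)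
    (hΛϑA : bigLam ε₀ * ϑA ≤ 1) (hωt : 0 ≤ ωt) (habart : 0 ≤ abart) (hrbart : 0 ≤ rbart) (hgHi : 0 ≤ gHi)
    (hγ : 0 ≤ γ) (α : Fin m → Fin m → Fin m → ℤ × ℤ × ℤ → ℝ) {A D R : ℤ → ℝ}
    (hAnn : ∀ k', 0 ≤ A k') (hDnn : ∀ k', 0 ≤ D k')
    (hD : ∀ j : ℕ, D ((F.W : ℤ) + j) ≤ ωt * ϑ ^ j) (hA : ∀ j : ℕ, A ((F.W : ℤ) + j) ≤ abart * ϑA ^ j)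
    (hR : ∀ j : ℕ, R ((F.W : ℤ) + j) ≤ rbart * σt ^ j) (hwt : ∀ j : ℕ, F.wt ((F.W : ℤ) + j) = ωt * ϑ ^ j)
    (hfirst : ∀ i, gHi * (ωt * ϑ ^ 2 + rbart * σt ^ 2 * F.rτ) + abart * ϑA ^ 2 * γ +
      F.τhi * (2 * tableAbsSum α i * (bigLam ε₀) ^ (F.W + 1) * ωt * abart) ≤ q * (ωt * ϑ))
    (i : Fin m) (n : ℕ) :
    gHi * (F.wt ((F.W : ℤ) + n + 1 + 1) + R ((F.W : ℤ) + n + 1 + 1) * F.rτ) + A ((F.W : ℤ) + n + 1 + 1) * γ +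
        F.τhi * quadTermLip ε₀ α A D i ((F.W : ℤ) + n + 1) ≤ q * F.wt ((F.W : ℤ) + n + 1) := by
  have hΛpos : 0 < bigLam ε₀ := bigLam_pos (by linarith)
  have hϑA1 : ϑA ≤ 1 := hϑAϑ.trans hϑ1
  have hrτ := F.rτ_pos.le
  have hτ := F.τhi_pos.le
  have e1 : ((F.W : ℤ) + n + 1 + 1) = (F.W : ℤ) + ((n + 2 : ℕ) : ℤ) := by push_cast; ring
  have e2 : ((F.W : ℤ) + n + 1) = (F.W : ℤ) + ((n + 1 : ℕ) : ℤ) := by push_cast; ring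
  rw [e1, hwt (n + 2)]
  rw [show F.wt ((F.W : ℤ) + n + 1) = ωt * ϑ ^ (n + 1) by rw [e2, hwt (n + 1)]]
  have hϑn : 0 ≤ ϑ ^ n := pow_nonneg hϑ0.le n
  have hT1 : ωt * ϑ ^ (n + 2) = ωt * ϑ ^ 2 * ϑ ^ n := by ring
  have hT2 : R ((F.W : ℤ) + ((n + 2 : ℕ) : ℤ)) * F.rτ ≤ rbart * σt ^ 2 * F.rτ * ϑ ^ n := by
    have h := hR (n + 2)
    have hσn : σt ^ n ≤ ϑ ^ n := pow_le_pow_left₀ hσt hσtϑ n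
    calc R ((F.W : ℤ) + ((n + 2 : ℕ) : ℤ)) * F.rτ ≤ rbart * σt ^ (n + 2) * F.rτ := mul_le_mul_of_nonneg_right h hrτ
      _ = rbart * σt ^ 2 * F.rτ * σt ^ n := by ring
      _ ≤ rbart * σt ^ 2 * F.rτ * ϑ ^ n := mul_le_mul_of_nonneg_left hσn (by positivity)
  have hT3 : A ((F.W : ℤ) + ((n + 2 : ℕ) : ℤ)) * γ ≤ abart * ϑA ^ 2 * γ * ϑ ^ n := by
    have h := hA (n + 2)
    have hϑAn : ϑA ^ n ≤ ϑ ^ n := pow_le_pow_left₀ hϑA0 hϑAϑ n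
    calc A ((F.W : ℤ) + ((n + 2 : ℕ) : ℤ)) * γ ≤ abart * ϑA ^ (n + 2) * γ := mul_le_mul_of_nonneg_right h hγ
      _ = abart * ϑA ^ 2 * γ * ϑA ^ n := by ring
      _ ≤ abart * ϑA ^ 2 * γ * ϑ ^ n := mul_le_mul_of_nonneg_left hϑAn (by positivity)
  have hS0 : 0 ≤ tableAbsSum α i := by
    unfold tableAbsSum
    exact Finset.sum_nonneg fun _ _ => Finset.sum_nonneg fun _ _ => Finset.sum_nonneg fun _ _ => abs_nonneg _
  have hT4 : quadTermLip ε₀ α A D i ((F.W : ℤ) + n + 1) ≤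
      2 * tableAbsSum α i * (bigLam ε₀) ^ (F.W + 1) * ωt * abart * ϑ ^ n := by
    refine (F.quadTermLip_top_le hε hΛ1 hϑ0.le hϑ1 hϑA0 hϑA1 hωt habart α hAnn hDnn hD hA i n).trans ?_
    -- `Λ^{W+n+1} ϑⁿ ϑ_Aⁿ = Λ^{W+1} (Λ ϑ ϑ_A)ⁿ ≤ Λ^{W+1} ϑⁿ`
    have hratio : (bigLam ε₀ * ϑA) ^ n ≤ 1 := pow_le_one₀ (by positivity) hΛϑA
    have hid : (bigLam ε₀) ^ (F.W + n + 1) * (ωt * ϑ ^ n) * (abart * ϑA ^ n) =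
        (bigLam ε₀) ^ (F.W + 1) * ωt * abart * ϑ ^ n * (bigLam ε₀ * ϑA) ^ n := by
      rw [show F.W + n + 1 = (F.W + 1) + n by ring, pow_add, mul_pow]; ring
    have hpos : 0 ≤ 2 * tableAbsSum α i * ((bigLam ε₀) ^ (F.W + 1) * ωt * abart * ϑ ^ n) := by positivity
    calc 2 * tableAbsSum α i * (bigLam ε₀) ^ (F.W + n + 1) * (ωt * ϑ ^ n) * (abart * ϑA ^ n)
        = 2 * tableAbsSum α i * ((bigLam ε₀) ^ (F.W + 1) * ωt * abart * ϑ ^ n) * (bigLam ε₀ * ϑA) ^ n := by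
          rw [mul_assoc (2 * tableAbsSum α i), mul_assoc (2 * tableAbsSum α i), hid]; ring
      _ ≤ 2 * tableAbsSum α i * ((bigLam ε₀) ^ (F.W + 1) * ωt * abart * ϑ ^ n) * 1 :=
          mul_le_mul_of_nonneg_left hratio hpos
      _ = _ := by ring
  have hsum := hfirst i
  calc gHi * (ωt * ϑ ^ (n + 2) + R ((F.W : ℤ) + ((n + 2 : ℕ) : ℤ)) * F.rτ) + A ((F.W : ℤ) + ((n + 2 : ℕ) : ℤ)) * γ +
        F.τhi * quadTermLip ε₀ α A D i ((F.W : ℤ) + n + 1)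
      ≤ gHi * (ωt * ϑ ^ 2 * ϑ ^ n + rbart * σt ^ 2 * F.rτ * ϑ ^ n) + abart * ϑA ^ 2 * γ * ϑ ^ n +
          F.τhi * (2 * tableAbsSum α i * (bigLam ε₀) ^ (F.W + 1) * ωt * abart * ϑ ^ n) := by
        rw [hT1]; gcongr
    _ = (gHi * (ωt * ϑ ^ 2 + rbart * σt ^ 2 * F.rτ) + abart * ϑA ^ 2 * γ +
          F.τhi * (2 * tableAbsSum α i * (bigLam ε₀) ^ (F.W + 1) * ωt * abart)) * ϑ ^ n := by ring
    _ ≤ q * (ωt * ϑ) * ϑ ^ n := mul_le_mul_of_nonneg_right hsum hϑn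
    _ = q * (ωt * ϑ ^ (n + 1)) := by ring

end OneShiftFrame

end DSSOneShift

end Summit.NavierStokesRegularity.NavierStokesRegularity.Theorems
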